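import Summits.ResolutionOfSingularities.ResolutionOfSingularities.Theorems.PurityTransfer.Negative.ResidueDeriv

/-!
# `PurityTransfer` (crux stmt-ResolutionOfSingularities-17142) — negative side, file 3/5:
# the field `H = 𝔽₂((ℤ ×ₗ ℤ))`, its parity decomposition and the CARTIER IDENTITY

`∂/∂x = D ex θx`, `∂/∂y = D ey θy` on `H` (`Dx_XH : ∂x/∂x = 1`, …, `Dx_Dy_comm`), the residue
functional `f ↦ f_{ℓ₀}` kills `∂/∂x`- and `∂/∂y`-exact series (`coeff_Dx_ℓ₀`, `coeff_Dy_ℓ₀`); every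
`b ∈ H` decomposes as `b = g₀² + x g₁² + y g₂² + x y g₃²` (`decompose`); and the Cartier identity
`halve (J(b,c) · b · c) = J(b,c)` (`halve_J`, an explicit characteristic-two polynomial identity in the
eight roots `gᵢ, hⱼ`), i.e. `C(dlog b ∧ dlog c) = dlog b ∧ dlog c` for the Cartier operator
(`halve_G`). Consequences used by the residue homomorphism: the residue of `(a² - a)·dlog b ∧ dlog c`
vanishes (`coeff_sq_mul_G`, Kato's Artin–Schreier relation) and the residue of
`b · dlog b ∧ dlog c = d(b · dlog c)` vanishes (`coeff_self_mul_G`). Nothing here refutes the crux.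
[folklore]
-/

noncomputable section

-- single-problem summit: the doubled namespace component `ResolutionOfSingularities` is forced
set_option linter.dupNamespace false

open Finset

namespace Summit.ResolutionOfSingularities.ResolutionOfSingularities.Theorems.PurityTransfer.Negative

section Concrete

/-- the `x`-character on an exponent. -/
theorem θx_apply (g : Γ₂) : θx g = ((ofLex g).2 : ZMod 2) := rfl
/-- the `y`-character on an exponent. -/
theorem θy_apply (g : Γ₂) : θy g = ((ofLex g).1 : ZMod 2) := rfl

/-- the `x`-character kills the shift of `∂/∂y` (so the two derivations commute). -/
theorem θx_ey : θx ey = 0 := by simp [θx_apply, ey]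
/-- the `y`-character kills the shift of `∂/∂x`. -/
theorem θy_ex : θy ex = 0 := by simp [θy_apply, ex]

/-- `ex = -gx`. -/
theorem ex_add_gx : ex + gx = 0 := rfl
/-- `ey = -gy`. -/
theorem ey_add_gy : ey + gy = 0 := rfl

/-- `∂x/∂x = 1`. -/
theorem Dx_XH : D ex θx XH = 1 := by
  rw [XH, D_single, ex_add_gx]
  have : θx gx * 1 = 1 := by decide
  rw [this]; rfl

/-- `∂y/∂x = 0`. -/
theorem Dx_YH : D ex θx YH = 0 := by
  rw [YH, D_single]
  have : θx gy * 1 = 0 := by decide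
  rw [this, HahnSeries.single_eq_zero]

/-- `∂x/∂y = 0`. -/
theorem Dy_XH : D ey θy XH = 0 := by
  rw [XH, D_single]
  have : θy gx * 1 = 0 := by decide
  rw [this, HahnSeries.single_eq_zero]

/-- `∂y/∂y = 1`. -/
theorem Dy_YH : D ey θy YH = 1 := by
  rw [YH, D_single, ey_add_gy]
  have : θy gy * 1 = 1 := by decide
  rw [this]; rfl

/-- the residue functional kills `∂/∂x`-exact series. -/
theorem coeff_Dx_ℓ₀ (f : H) : (D ex θx f).coeff ℓ₀ = 0 := by
  rw [coeff_D]
  have : θx (ℓ₀ - ex) = 0 := by decide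
  rw [this, zero_mul]

/-- the residue functional kills `∂/∂y`-exact series. -/
theorem coeff_Dy_ℓ₀ (f : H) : (D ey θy f).coeff ℓ₀ = 0 := by
  rw [coeff_D]
  have : θy (ℓ₀ - ey) = 0 := by decide
  rw [this, zero_mul]

/-- mixed partials commute: `∂/∂x ∂/∂y = ∂/∂y ∂/∂x` on `H`. -/
theorem Dx_Dy_comm (f : H) : D ex θx (D ey θy f) = D ey θy (D ex θx f) := D_comm ex ey θx θy θx_ey θy_ex f

/-- `2 = 0` in `H`. -/
theorem two_eq_zero_H : (2 : H) = 0 := by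
  simpa using CharP.cast_eq_zero H 2

/-- derivations kill squares in characteristic `2`: `D (r²) = 0`. -/
theorem D_mul_self (e : Γ₂) (θ : Γ₂ →+ ZMod 2) (r : H) : D e θ (r * r) = 0 := by
  rw [D_mul]
  have : D e θ r * r + r * D e θ r = 2 * (r * D e θ r) := by ring
  rw [this, two_eq_zero_H, zero_mul]

/-! ### halving monomials -/

/-- first coordinate of `2γ - ℓ`. -/
theorem fst_dbl (ℓ γ : Γ₂) : (ofLex (dbl ℓ γ)).1 = 2 * (ofLex γ).1 - (ofLex ℓ).1 := by
  simp only [dbl, ofLex_sub, ofLex_add, Prod.fst_sub, Prod.fst_add]; ring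

/-- second coordinate of `2γ - ℓ`. -/
theorem snd_dbl (ℓ γ : Γ₂) : (ofLex (dbl ℓ γ)).2 = 2 * (ofLex γ).2 - (ofLex ℓ).2 := by
  simp only [dbl, ofLex_sub, ofLex_add, Prod.snd_sub, Prod.snd_add]; ring

/-- `halve 1 = 0` (the constant monomial is not in the odd-odd class). -/
theorem halve_ℓ₀_one : halve ℓ₀ (1 : H) = 0 := by
  rw [show (1 : H) = HahnSeries.single 0 1 from rfl]
  apply halve_single_of_not_mem_range
  intro γ h
  have := congrArg (fun g : Γ₂ => (ofLex g).1) h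
  simp only [fst_dbl, ℓ₀] at this
  simp at this
  omega

/-- `halve x = 0`. -/
theorem halve_ℓ₀_XH : halve ℓ₀ XH = 0 := by
  apply halve_single_of_not_mem_range
  intro γ h
  have := congrArg (fun g : Γ₂ => (ofLex g).1) h
  simp only [fst_dbl, ℓ₀, gx] at this
  simp at this
  omega

/-- `halve y = 0`. -/
theorem halve_ℓ₀_YH : halve ℓ₀ YH = 0 := by
  apply halve_single_of_not_mem_range
  intro γ h
  have := congrArg (fun g : Γ₂ => (ofLex g).2) h
  simp only [snd_dbl, ℓ₀, gy] at this
  simp at this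
  omega

/-- `x · y` is the monomial of exponent `2·0 - ℓ₀`. -/
theorem XH_mul_YH : XH * YH = HahnSeries.single (dbl ℓ₀ 0) 1 := by
  rw [XH, YH, HahnSeries.single_mul_single, mul_one]
  rfl

/-- `halve (x y) = 1`. -/
theorem halve_ℓ₀_XH_mul_YH : halve ℓ₀ (XH * YH) = 1 := by
  rw [XH_mul_YH, halve_single_dbl]; rfl

/-! ### squares and the parity decomposition -/

/-- coefficient of a square at a doubled exponent. -/
theorem coeff_sq_double (r : H) (α : Γ₂) : (r * r).coeff (α + α) = r.coeff α := by
  have hsq : ∀ s : ZMod 2, s * s = s := by decide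
  rw [coeff_mul_self_add_self, hsq]

/-- coefficient of a square at a non-doubled exponent (odd first coordinate). -/
theorem coeff_sq_of_fst_odd (r : H) (δ : Γ₂) (h : ¬ Even (ofLex δ).1) : (r * r).coeff δ = 0 := by
  apply coeff_mul_self_eq_zero
  intro α _ hα
  apply h
  rw [← hα]
  simp only [ofLex_add, Prod.fst_add]
  exact ⟨_, rfl⟩

/-- coefficient of a square at a non-doubled exponent (odd second coordinate). -/
theorem coeff_sq_of_snd_odd (r : H) (δ : Γ₂) (h : ¬ Even (ofLex δ).2) : (r * r).coeff δ = 0 := by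
  apply coeff_mul_self_eq_zero
  intro α _ hα
  apply h
  rw [← hα]
  simp only [ofLex_add, Prod.snd_add]
  exact ⟨_, rfl⟩

/-- coefficients of `x · f`. -/
theorem coeff_XH_mul (f : H) (δ : Γ₂) : (XH * f).coeff δ = f.coeff (δ - gx) := by
  rw [XH, HahnSeries.coeff_single_mul, one_mul]

/-- coefficients of `y · f`. -/
theorem coeff_YH_mul (f : H) (δ : Γ₂) : (YH * f).coeff δ = f.coeff (δ - gy) := by
  rw [YH, HahnSeries.coeff_single_mul, one_mul]

/-- coefficients of `x y · f`. -/
theorem coeff_XH_YH_mul (f : H) (δ : Γ₂) : (XH * YH * f).coeff δ = f.coeff (δ - gx - gy) := by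
  rw [mul_assoc, coeff_XH_mul, coeff_YH_mul, sub_sub, add_comm, ← sub_sub]

/-- **parity decomposition** of a Hahn series over `𝔽₂`: `b = g₀² + x g₁² + y g₂² + x y g₃²`
with `gᵢ` the halvings of the four parity classes. -/
theorem decompose (b : H) :
    b = halve 0 b * halve 0 b + XH * (halve ex b * halve ex b) + YH * (halve ey b * halve ey b)
      + XH * YH * (halve ℓ₀ b * halve ℓ₀ b) := by
  ext δ
  simp only [HahnSeries.coeff_add]
  rw [coeff_XH_mul, coeff_YH_mul, coeff_XH_YH_mul]
  induction δ using Lex.rec with | _ δ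
  obtain ⟨m, n⟩ := δ
  rcases Int.even_or_odd' m with ⟨i, rfl | rfl⟩ <;> rcases Int.even_or_odd' n with ⟨j, rfl | rfl⟩
  · -- (even, even)
    have e1 : toLex (2 * i, 2 * j) = (toLex (i, j) : Γ₂) + toLex (i, j) := by
      change toLex (2 * i, 2 * j) = toLex ((i, j) + (i, j)); congr 1; ext <;> simp <;> ring
    have f1 : (toLex (i, j) : Γ₂) + toLex (i, j) - 0 = toLex (2 * i, 2 * j) := by
      rw [sub_zero]; exact e1.symm
    rw [e1, coeff_sq_double, coeff_halve, f1,
      coeff_sq_of_snd_odd, coeff_sq_of_fst_odd, coeff_sq_of_fst_odd]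
    · simp [← e1]
    · simp [gx, gy]
    · simp [gy]
    · simp [gx]
  · -- (even, odd)
    have e2 : (toLex (2 * i, 2 * j + 1) : Γ₂) - gx = (toLex (i, j + 1) : Γ₂) + toLex (i, j + 1) := by
      change toLex ((2 * i, 2 * j + 1) - ((0 : ℤ), (-1 : ℤ))) = toLex ((i, j + 1) + (i, j + 1))
      congr 1; ext <;> simp <;> ring
    have f2 : (toLex (i, j + 1) : Γ₂) + toLex (i, j + 1) - ex = toLex (2 * i, 2 * j + 1) := by
      change toLex ((i, j + 1) + (i, j + 1) - ((0 : ℤ), (1 : ℤ))) = toLex (2 * i, 2 * j + 1)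
      congr 1; ext <;> simp <;> ring
    rw [e2, coeff_sq_double, coeff_halve, f2, coeff_sq_of_snd_odd, coeff_sq_of_fst_odd,
      coeff_sq_of_fst_odd]
    · simp
    · simp [gy]
    · simp [gy]
    · simp
  · -- (odd, even)
    have e3 : (toLex (2 * i + 1, 2 * j) : Γ₂) - gy = (toLex (i + 1, j) : Γ₂) + toLex (i + 1, j) := by
      change toLex ((2 * i + 1, 2 * j) - ((-1 : ℤ), (0 : ℤ))) = toLex ((i + 1, j) + (i + 1, j))
      congr 1; ext <;> simp <;> ring
    have f3 : (toLex (i + 1, j) : Γ₂) + toLex (i + 1, j) - ey = toLex (2 * i + 1, 2 * j) := by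
      change toLex ((i + 1, j) + (i + 1, j) - ((1 : ℤ), (0 : ℤ))) = toLex (2 * i + 1, 2 * j)
      congr 1; ext <;> simp <;> ring
    rw [e3, coeff_sq_double, coeff_halve, f3, coeff_sq_of_fst_odd, coeff_sq_of_snd_odd,
      coeff_sq_of_snd_odd]
    · simp
    · simp [gx, gy]
    · simp [gx]
    · simp
  · -- (odd, odd)
    have e4 : (toLex (2 * i + 1, 2 * j + 1) : Γ₂) - gx - gy
        = (toLex (i + 1, j + 1) : Γ₂) + toLex (i + 1, j + 1) := by
      change toLex ((2 * i + 1, 2 * j + 1) - ((0 : ℤ), (-1 : ℤ)) - ((-1 : ℤ), (0 : ℤ)))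
        = toLex ((i + 1, j + 1) + (i + 1, j + 1))
      congr 1; ext <;> simp <;> ring
    have f4 : (toLex (i + 1, j + 1) : Γ₂) + toLex (i + 1, j + 1) - ℓ₀ = toLex (2 * i + 1, 2 * j + 1) := by
      change toLex ((i + 1, j + 1) + (i + 1, j + 1) - ((1 : ℤ), (1 : ℤ))) = toLex (2 * i + 1, 2 * j + 1)
      congr 1; ext <;> simp <;> ring
    rw [e4, coeff_sq_double, coeff_halve, f4, coeff_sq_of_fst_odd, coeff_sq_of_fst_odd,
      coeff_sq_of_snd_odd]
    · simp
    · simp [gy]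
    · simp [gx]
    · simp

/-! ### the Cartier identity -/

/-- `G(b,c) = J(b,c) / (b c)`. -/
theorem G_eq (b c : H) : G b c = J b c * (b⁻¹ * c⁻¹) := by
  unfold G J dlog; ring

/-- **Cartier identity, polynomial form**: `halve (J(b,c)·b·c) = J(b,c)`. -/
theorem halve_J (b c : H) : halve ℓ₀ (J b c * b * c) = J b c := by
  obtain ⟨g₀, g₁, g₂, g₃, hb⟩ : ∃ g₀ g₁ g₂ g₃ : H,
      b = g₀ * g₀ + XH * (g₁ * g₁) + YH * (g₂ * g₂) + XH * YH * (g₃ * g₃) := ⟨_, _, _, _, decompose b⟩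
  obtain ⟨h₀, h₁, h₂, h₃, hc⟩ : ∃ h₀ h₁ h₂ h₃ : H,
      c = h₀ * h₀ + XH * (h₁ * h₁) + YH * (h₂ * h₂) + XH * YH * (h₃ * h₃) := ⟨_, _, _, _, decompose c⟩
  have hDx : ∀ u₀ u₁ u₂ u₃ : H, D ex θx (u₀ * u₀ + XH * (u₁ * u₁) + YH * (u₂ * u₂) + XH * YH * (u₃ * u₃))
      = u₁ * u₁ + YH * (u₃ * u₃) := by
    intro u₀ u₁ u₂ u₃
    simp only [D_add, D_mul, Dx_XH, Dx_YH]; grind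
  have hDy : ∀ u₀ u₁ u₂ u₃ : H, D ey θy (u₀ * u₀ + XH * (u₁ * u₁) + YH * (u₂ * u₂) + XH * YH * (u₃ * u₃))
      = u₂ * u₂ + XH * (u₃ * u₃) := by
    intro u₀ u₁ u₂ u₃
    simp only [D_add, D_mul, Dy_XH, Dy_YH]; grind
  set A := g₁ * h₂ + g₂ * h₁ with hA
  set B := g₁ * h₃ + g₃ * h₁ with hB
  set C := g₂ * h₃ + g₃ * h₂ with hC
  have hJ : J b c = A * A + XH * (B * B) + YH * (C * C) := by
    unfold J; rw [hb, hc, hDx, hDy, hDx, hDy, hA, hB, hC]; grind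
  set q₀ := g₀ * h₀ + XH * (g₁ * h₁) + YH * (g₂ * h₂) + XH * YH * (g₃ * h₃) with hq₀
  set q₁ := g₀ * h₁ + g₁ * h₀ + YH * (g₂ * h₃ + g₃ * h₂) with hq₁
  set q₂ := g₀ * h₂ + g₂ * h₀ + XH * (g₁ * h₃ + g₃ * h₁) with hq₂
  set q₃ := g₀ * h₃ + g₃ * h₀ + g₁ * h₂ + g₂ * h₁ with hq₃
  have hbc : b * c = q₀ * q₀ + XH * (q₁ * q₁) + YH * (q₂ * q₂) + XH * YH * (q₃ * q₃) := by
    rw [hb, hc, hq₀, hq₁, hq₂, hq₃]; grind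
  set U := A * q₀ + XH * (B * q₁) + YH * (C * q₂) with hU
  set V := A * q₁ + B * q₀ + YH * (C * q₃) with hV
  set W := A * q₂ + C * q₀ + XH * (B * q₃) with hW
  set Z := A * q₃ + B * q₂ + C * q₁ with hZ
  have hprod : J b c * b * c
      = U * U * 1 + V * V * XH + W * W * YH + Z * Z * (XH * YH) := by
    rw [mul_assoc, hbc, hJ, hU, hV, hW, hZ]; grind
  have hZJ : Z = J b c := by
    rw [hJ, hZ, hA, hB, hC, hq₁, hq₂, hq₃]; grind
  rw [hprod, halve_add, halve_add, halve_add, halve_mul_self_mul, halve_mul_self_mul,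
    halve_mul_self_mul, halve_mul_self_mul, halve_ℓ₀_one, halve_ℓ₀_XH, halve_ℓ₀_YH,
    halve_ℓ₀_XH_mul_YH, mul_zero, mul_zero, mul_zero, zero_add, zero_add, zero_add, mul_one, hZJ]

/-- **Cartier identity**: `G(b,c)` (the coefficient of `dlog b ∧ dlog c`) is fixed by halving. -/
theorem halve_G {b c : H} (hb : b ≠ 0) (hc : c ≠ 0) : halve ℓ₀ (G b c) = G b c := by
  have hu : G b c = (b⁻¹ * c⁻¹) * (b⁻¹ * c⁻¹) * (J b c * b * c) := by
    rw [G_eq]; field_simp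
  conv_lhs => rw [hu]
  rw [halve_mul_self_mul, halve_J, G_eq]; ring

/-- **R7 core** (Artin–Schreier compatibility): the residue of `a² · dlog b ∧ dlog c` equals that
of `a · dlog b ∧ dlog c`. -/
theorem coeff_sq_mul_G (a : H) {b c : H} (hb : b ≠ 0) (hc : c ≠ 0) :
    (a * a * G b c).coeff ℓ₀ = (a * G b c).coeff ℓ₀ := by
  rw [← coeff_halve_self ℓ₀ (a * a * G b c), halve_mul_self_mul, halve_G hb hc]

/-- **R5 core**: `b · dlog b ∧ dlog c = d(b · dlog c)` is exact, so its residue vanishes. -/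
theorem coeff_self_mul_G {b c : H} (hb : b ≠ 0) (hc : c ≠ 0) :
    (b * G b c).coeff ℓ₀ = 0 := by
  have h1 : b * G b c = D ex θx (b * dlog ey θy c) - D ey θy (b * dlog ex θx c) := by
    rw [D_mul, D_mul, D_dlog_comm ex ey θx θy θx_ey θy_ex hc]
    unfold G
    have hbinv : b * b⁻¹ = 1 := mul_inv_cancel₀ hb
    unfold dlog
    rw [show b * (D ex θx b * b⁻¹ * (D ey θy c * c⁻¹) - D ey θy b * b⁻¹ * (D ex θx c * c⁻¹))
        = (b * b⁻¹) * (D ex θx b * (D ey θy c * c⁻¹) - D ey θy b * (D ex θx c * c⁻¹)) by ring,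
      hbinv]
    ring
  rw [h1, HahnSeries.coeff_sub, coeff_Dx_ℓ₀, coeff_Dy_ℓ₀, sub_zero]

/-- `G` is antisymmetric. -/
theorem G_swap (b c : H) : G c b = -G b c := by unfold G; ring

/-- `G(b,b) = 0` (`dlog b ∧ dlog b = 0`). -/
theorem G_self (b : H) : G b b = 0 := by unfold G; ring

/-- `G` is logarithmic in the first slot: `G(bb', c) = G(b,c) + G(b',c)`. -/
theorem G_mul_left {b b' c : H} (hb : b ≠ 0) (hb' : b' ≠ 0) :
    G (b * b') c = G b c + G b' c := by
  unfold G; rw [dlog_mul ex θx hb hb', dlog_mul ey θy hb hb']; ring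

/-- `G` is logarithmic in the second slot. -/
theorem G_mul_right {b c c' : H} (hc : c ≠ 0) (hc' : c' ≠ 0) :
    G b (c * c') = G b c + G b c' := by
  unfold G; rw [dlog_mul ex θx hc hc', dlog_mul ey θy hc hc']; ring

/-- the residue of `dlog x ∧ dlog y` is `1`. -/
theorem coeff_G_XH_YH : (G XH YH).coeff ℓ₀ = 1 := by
  have : G XH YH = HahnSeries.single ℓ₀ 1 := by
    unfold G dlog
    rw [Dx_XH, Dy_YH, Dy_XH, Dx_YH]
    simp only [one_mul, zero_mul, sub_zero]
    rw [XH, YH, HahnSeries.inv_single, HahnSeries.inv_single, inv_one,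
      HahnSeries.single_mul_single, mul_one]
    rfl
  rw [this, HahnSeries.coeff_single_same]

end Concrete

end Summit.ResolutionOfSingularities.ResolutionOfSingularities.Theorems.PurityTransfer.Negative
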